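import Summits.QuantumFields.BalabanUV.T4Continuum.Support.NE3TangentNoGoFlat
import Summits.QuantumFields.BalabanUV.T4Continuum.Support.NE3HessForm
import Summits.QuantumFields.BalabanUV.T4Continuum.Support.NE3EnergyShapes
import Mathlib.Analysis.SpecialFunctions.Complex.Log
import HarnessLib

/-!
# T⁴ programme, node NE3 — NO-GO for k-uniform tangent coercivity in the unit-scale energy norm, part 3:
# the wave witness at level k — skew, periodic, divergence-free, tangent — and its FORMS at the flat background

NE3 prover lineage P1, gen 19 (cell `pub-balaban`, unit `b2b-balaban-t4-ne3-p1`, row NE3 OWNER); located error G-ne3p1-g19-1.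
For the witness `X_k = wave 0 i₁ L^{−k} 1 0` of part 2 (`cos(2πx_{i₁}/L^k)·(i·1)` on the direction-0 bonds) this file proves:
skew, `(N·L^k)`-periodic, Landau at `W = 1`, non-zero, `TangentIter L (k−1) 1 X_k` (part 2 by name); and AT THE FLAT BACKGROUND
`dcurlAt V X_k Y = 0` (central values: every term is a commutator), `hessPlaq 1 X_k X_k p = ‖curl 1 X_k p‖²` (for central directions
the Wilson Hessian density IS the squared dressed curl), `hess 1 X_k X_k (perWin d P) = curlSq 1 X_k (periodBox P)`,
`dirSq X_k (periodBox P) = P^{d−1}·Σ_{t<P} cos²(2πt/L^k)`, `curlSq … = P^{d−1}·Σ_{t<P} (cos(2πt/L^k) − cos(2π(t+1)/L^k))²` (only the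
planes `(0, i₁)` carry curl), and the two trigonometric block sums `Σ_{t<P} cos²(2πt/M + ψ) = P/2`,
`Σ_{t<P}(cos(2πt/M) − cos(2π(t+1)/M))² = 4 sin²(π/M)·P/2` for `3 ≤ M ∣ P` (roots of unity).  Part 4 (`NE3TangentNoGo`) draws
the conclusion `hess ≤ (4π²/L^{2k})·energyNorm²`.

CONTENT (1 abbrev = the witness `Xw`, 0 sorry): §1 trigonometric sums; §2 the witness; §3 its forms at the flat background.

HONEST FRAMING.  Lattice kinematics at the FLAT configuration (our frame); nothing about minimisers, T-E, (H∃) or NE3 is asserted;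
NE3 NOT proved; spine 0∕9; finite T⁴ rung (B)+1 — NOT infinite volume, NOT mass gap, NOT Clay.  PLACEMENT: `Summits/QuantumFields/BalabanUV/`.
-/

set_option autoImplicit false

open scoped BigOperators Matrix.Norms.L2Operator
open Finset

namespace Summit.QuantumFields.BalabanUV.T4Continuum.NE3TangentNoGoForms

open Literature.MathematicalPhysics.QuantumFieldTheory.Balaban1983to89
open B7Prop1Explicit B7Prop2Explicit UnitaryModel
open T4AveragingDeficitWall hiding Site Plane Plaq Bond
open T4AveragingDeficitWallBoundary (periodBox mem_periodBox)
open AveragingDeficitPeriodicCounting (IsPeriodicDir)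
open AveragingDeficitMultiLevelPrep (TangentIter)
open BlockAveragePushDirSplit (flat)
open MinimalActionLevels (perWin)
open NE3HessForm (hess hessPlaq hessPlaqAt dcurlAt)
open NE3EnergyShapes (energyNorm)
open NE3TangentNoGoWords NE3TangentNoGoFlat

noncomputable section

variable {d : ℕ} {n : Type*} [Fintype n] [DecidableEq n]

/-! ## §1 Trigonometric sums over a period -/

/-- `Σ_{t<P} e^{i(4πt/M + φ)} = 0` for `3 ≤ M`, `M ∣ P` (the phases `e^{4πit/M}` are `M′`-th roots of unity, `M′ ≥ 2`). [folklore] -/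
theorem sum_exp_two_freq_eq_zero {M P : ℕ} (hM : 3 ≤ M) (hMP : M ∣ P) (φ : ℝ) :
    ∑ t ∈ range P, Complex.exp (((4 * Real.pi * t / M + φ : ℝ) : ℂ) * Complex.I) = 0 := by
  obtain ⟨N, rfl⟩ := hMP
  have hM0 : (M : ℝ) ≠ 0 := by exact_mod_cast (by omega : M ≠ 0)
  have hM0c : (M : ℂ) ≠ 0 := by exact_mod_cast (by omega : M ≠ 0)
  set ζ : ℂ := Complex.exp (((4 * Real.pi / M : ℝ) : ℂ) * Complex.I) with hζ
  have hterm : ∀ t : ℕ, Complex.exp (((4 * Real.pi * t / M + φ : ℝ) : ℂ) * Complex.I)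
      = Complex.exp ((φ : ℂ) * Complex.I) * ζ ^ t := by
    intro t
    rw [hζ, ← Complex.exp_nat_mul, ← Complex.exp_add]
    congr 1
    push_cast
    ring
  simp_rw [hterm]
  rw [← mul_sum]
  have hζ1 : ζ ≠ 1 := by
    intro h
    rw [hζ, Complex.exp_eq_one_iff] at h
    obtain ⟨j, hj⟩ := h
    have him := congrArg Complex.im hj
    simp only [Complex.mul_im, Complex.ofReal_re, Complex.ofReal_im, Complex.I_re, Complex.I_im, mul_zero, mul_one,
      zero_add, Complex.mul_re, Complex.intCast_re, Complex.intCast_im, Complex.re_ofNat, Complex.im_ofNat,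
      zero_mul, sub_zero] at him
    -- `4π/M = 2π j` ⇒ `2 = j·M` with `M ≥ 3`: impossible
    have h2 : (2 : ℝ) = j * M := by
      field_simp at him
      nlinarith [Real.pi_pos]
    have h2z : (2 : ℤ) = j * M := by exact_mod_cast h2
    rcases le_or_gt j 0 with hj0 | hj0
    · nlinarith
    · nlinarith
  have hζP : ζ ^ (M * N) = 1 := by
    rw [hζ, ← Complex.exp_nat_mul, Complex.exp_eq_one_iff]
    refine ⟨2 * N, ?_⟩
    push_cast
    field_simp
    ring
  rw [geom_sum_eq hζ1, hζP, sub_self, zero_div, mul_zero]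

/-- `Σ_{t<P} cos(4πt/M + φ) = 0` for `3 ≤ M ∣ P`. [folklore] -/
theorem sum_cos_two_freq_eq_zero {M P : ℕ} (hM : 3 ≤ M) (hMP : M ∣ P) (φ : ℝ) :
    ∑ t ∈ range P, Real.cos (4 * Real.pi * t / M + φ) = 0 := by
  have h := congrArg Complex.re (sum_exp_two_freq_eq_zero hM hMP φ)
  rw [Complex.re_sum, Complex.zero_re] at h
  simp only [Complex.exp_ofReal_mul_I_re] at h
  exact h

/-- **`Σ_{t<P} cos²(2πt/M + ψ) = P/2`** for `3 ≤ M ∣ P`. [folklore] -/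
theorem sum_cos_sq_eq {M P : ℕ} (hM : 3 ≤ M) (hMP : M ∣ P) (ψ : ℝ) :
    ∑ t ∈ range P, Real.cos (2 * Real.pi * t / M + ψ) ^ 2 = (P : ℝ) / 2 := by
  simp_rw [Real.cos_sq]
  rw [sum_add_distrib, sum_const, card_range, ← sum_div, nsmul_eq_mul]
  have h := sum_cos_two_freq_eq_zero hM hMP (2 * ψ)
  have h' : ∑ t ∈ range P, Real.cos (2 * (2 * Real.pi * t / M + ψ)) = 0 := by
    rw [← h]; refine sum_congr rfl fun t _ => ?_; congr 1; ring
  rw [h', zero_div, add_zero]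
  ring

/-! ## §2 The witness -/

variable (n) in
/-- THE WAVE WITNESS at level `k`: `X_k(x, i₀) = cos(2π·x_{i₁}/L^k)·(i·1)`, zero on the other bonds (= part 2's
`wave i₀ i₁ L^{−k} 1 0`). [folklore] -/
abbrev Xw (i₀ i₁ : Fin d) (L k : ℕ) : Site d → Fin d → Matrix n n ℂ := wave (n := n) i₀ i₁ (1 / (L : ℝ) ^ k) 1 0

variable {i₀ i₁ : Fin d}

/-- The witness is the bare profile wave (its exact term has amplitude `0`). [folklore] -/
theorem Xw_apply (L k : ℕ) (x : Site d) (μ : Fin d) :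
    Xw n i₀ i₁ L k x μ = if μ = i₀ then cen (Real.cos (2 * Real.pi * (1 / (L : ℝ) ^ k) * x i₁)) else 0 := by
  simp [Xw, wave, prof, dPot, cwave_one]

omit [Fintype n] in
/-- Central elements are skew. [folklore] -/
theorem cen_mem_skewAdjoint (r : ℝ) : (cen r : Matrix n n ℂ) ∈ skewAdjoint (Matrix n n ℂ) := by
  rw [skewAdjoint.mem_iff, cen, Matrix.star_eq_conjTranspose, Matrix.conjTranspose_smul, Matrix.conjTranspose_one,
    ← neg_smul]
  congr 1
  rw [star_mul', Complex.star_def, Complex.conj_ofReal, Complex.conj_I]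
  ring

/-- The witness is a skew direction. [folklore] -/
theorem isSkewDir_Xw (L k : ℕ) : IsSkewDir (Xw n i₀ i₁ L k) := by
  intro x μ
  rw [Xw_apply]
  split_ifs
  · exact cen_mem_skewAdjoint _
  · exact (skewAdjoint _).zero_mem

/-- The witness is `(N·L^k)`-periodic. [folklore] -/
theorem isPeriodicDir_Xw {L : ℕ} (hL : 1 ≤ L) (N k : ℕ) : IsPeriodicDir (Xw n i₀ i₁ L k) ((N * L ^ k : ℕ) : ℤ) := by
  intro x κ μ
  rw [Xw_apply, Xw_apply]
  have hL0 : (L : ℝ) ^ k ≠ 0 := pow_ne_zero _ (by exact_mod_cast (by omega : L ≠ 0))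
  have hcos : Real.cos (2 * Real.pi * (1 / (L : ℝ) ^ k) * ((x + ((N * L ^ k : ℕ) : ℤ) • e κ) i₁ : ℤ))
      = Real.cos (2 * Real.pi * (1 / (L : ℝ) ^ k) * (x i₁ : ℤ)) := by
    simp only [Pi.add_apply, Pi.smul_apply, e_apply, smul_eq_mul]
    split_ifs
    · rw [mul_one, Int.cast_add, show (((N * L ^ k : ℕ) : ℤ) : ℝ) = (N : ℝ) * (L : ℝ) ^ k by push_cast; ring, mul_add,
        show 2 * Real.pi * (1 / (L : ℝ) ^ k) * ((N : ℝ) * (L : ℝ) ^ k) = (N : ℕ) * (2 * Real.pi) by field_simp,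
        Real.cos_add_nat_mul_two_pi]
    · rw [mul_zero, add_zero]
  rw [hcos]

/-- The witness is divergence-free at the flat background (Landau condition `D*X = 0` at `W = 1`). [folklore] -/
theorem div_Xw_eq_zero (h01 : i₀ ≠ i₁) (L k : ℕ) (x : Site d) :
    ∑ μ : Fin d, (Xw n i₀ i₁ L k x μ - Xw n i₀ i₁ L k (x - e μ) μ) = 0 := by
  refine sum_eq_zero fun μ _ => ?_
  rw [Xw_apply, Xw_apply]
  split_ifs with h
  · subst h
    rw [show x - e μ = x + (-1 : ℤ) • e μ by simp [sub_eq_add_neg], coord_add_zsmul_e_of_ne h01, sub_self]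
  · rw [sub_zero]

/-- The witness is not the zero direction (`n` non-empty). [folklore] -/
theorem Xw_ne_zero [Nonempty n] (L k : ℕ) : Xw n i₀ i₁ L k ≠ 0 := by
  intro h
  have h0 := congrFun (congrFun h 0) i₀
  rw [Xw_apply, if_pos rfl, Pi.zero_apply, Pi.zero_apply] at h0
  simp only [Pi.zero_apply, Int.cast_zero, mul_zero, Real.cos_zero, cen, Complex.ofReal_one, one_mul] at h0
  have h1 := congrArg (fun M : Matrix n n ℂ => M (Classical.arbitrary n) (Classical.arbitrary n)) h0
  simp at h1

/-- The witness is a k-fold tangent vector at the flat background (part 2). [folklore] -/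
theorem tangentIter_Xw {m : ℕ} {i₀ i₁ : Fin (m + 2)} (h0 : (i₀ : ℕ) = 0) (h01 : i₀ ≠ i₁) {L : ℕ} (hL : 2 ≤ L) {k : ℕ}
    (hk : 1 ≤ k) : TangentIter L (k - 1) (flat (d := m + 2) (n := n)) (Xw n i₀ i₁ L k) :=
  tangentIter_wave h0 h01 hL hk 1 0

/-! ## §3 The forms of the witness at the flat background -/

/-- Central elements commute with everything. [folklore] -/
theorem cen_comm (r : ℝ) (B : Matrix n n ℂ) : cen r * B = B * cen r := by
  simp [cen]

/-- Every value of the witness commutes with everything. [folklore] -/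
theorem Xw_comm (L k : ℕ) (x : Site d) (μ : Fin d) (B : Matrix n n ℂ) :
    Xw n i₀ i₁ L k x μ * B = B * Xw n i₀ i₁ L k x μ := by
  rw [Xw_apply]
  split_ifs
  · exact cen_comm _ B
  · simp

/-- `Ad_u 0 = 0`. [folklore] -/
theorem Ad_zero (u : (Matrix n n ℂ)ˣ) : Ad u 0 = 0 := by simp [Ad]

/-- **The derivative of the dressed curl vanishes on a central direction**: every term of `dcurlAt V X Y` is a (transported)
commutator `A·B − B·A` with `A` a value (or difference of values) of `X`. [folklore] -/
theorem dcurlAt_Xw_eq_zero (L k : ℕ) (V : Site d → Fin d → (Matrix n n ℂ)ˣ) (Y : Site d → Fin d → Matrix n n ℂ)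
    (z : Site d) (μ ν : Fin d) : dcurlAt V (Xw n i₀ i₁ L k) Y z μ ν = 0 := by
  have hc : ∀ (x : Site d) (κ : Fin d) (B : Matrix n n ℂ), Xw n i₀ i₁ L k x κ * B - B * Xw n i₀ i₁ L k x κ = 0 :=
    fun x κ B => by rw [Xw_comm, sub_self]
  have hc2 : ∀ (x x' : Site d) (κ κ' : Fin d) (B : Matrix n n ℂ),
      (Xw n i₀ i₁ L k x κ - Xw n i₀ i₁ L k x' κ') * B - B * (Xw n i₀ i₁ L k x κ - Xw n i₀ i₁ L k x' κ') = 0 :=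
    fun x x' κ κ' B => by rw [sub_mul, mul_sub, Xw_comm, Xw_comm L k x']; abel
  unfold dcurlAt
  simp only [hc, hc2, Ad_zero, add_zero, sub_self]

/-- At the flat background the dressed curl of the witness is a central element: `curlAt 1 X z μ ν = cen(Δ)` with
`Δ = [μ = i₀](f(z) − f(z + e_ν)) + [ν = i₀](f(z + e_μ) − f(z))`, `f(x) = cos(2πx_{i₁}/L^k)`. [folklore] -/
theorem curlAt_flat_Xw (L k : ℕ) (z : Site d) (μ ν : Fin d) :
    curlAt (flat (d := d) (n := n)) (Xw n i₀ i₁ L k) z μ ν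
      = cen ((if μ = i₀ then Real.cos (2 * Real.pi * (1 / (L : ℝ) ^ k) * z i₁)
              - Real.cos (2 * Real.pi * (1 / (L : ℝ) ^ k) * (z + e ν) i₁) else 0)
          + (if ν = i₀ then Real.cos (2 * Real.pi * (1 / (L : ℝ) ^ k) * (z + e μ) i₁)
              - Real.cos (2 * Real.pi * (1 / (L : ℝ) ^ k) * z i₁) else 0)) := by
  simp only [curlAt, flat, Ad, Units.val_one, inv_one, one_mul, mul_one, Xw_apply]
  split_ifs <;> simp [cen_sub]
  all_goals abel

/-- The product of two central elements: `cen a · cen b = −(ab)·1`. [folklore] -/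
theorem cen_mul_cen (a b : ℝ) : (cen a : Matrix n n ℂ) * cen b = (((-(a * b) : ℝ)) : ℂ) • (1 : Matrix n n ℂ) := by
  rw [cen, cen, Matrix.smul_mul, Matrix.mul_smul, Matrix.one_mul, smul_smul]
  congr 1
  rw [show (a : ℂ) * Complex.I * ((b : ℂ) * Complex.I) = (a * b : ℂ) * (Complex.I * Complex.I) by ring, Complex.I_mul_I]
  push_cast
  ring

/-- `nReTr (c·1) = Re c` (`n` non-empty). [folklore] -/
theorem nReTr_smul_one [Nonempty n] (c : ℂ) : nReTr (c • (1 : Matrix n n ℂ)) = c.re := by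
  have hn : (Fintype.card n : ℝ) ≠ 0 := by exact_mod_cast Fintype.card_ne_zero
  simp only [nReTr, Matrix.trace_smul, Matrix.trace_one, smul_eq_mul, Complex.mul_re, Complex.natCast_re,
    Complex.natCast_im, mul_zero, sub_zero]
  field_simp

/-- `nReTr (cen a · cen b) = −ab` (`n` non-empty). [folklore] -/
theorem nReTr_cen_mul_cen [Nonempty n] (a b : ℝ) : nReTr ((cen a : Matrix n n ℂ) * cen b) = -(a * b) := by
  rw [cen_mul_cen, nReTr_smul_one, Complex.ofReal_re]

/-- `‖cen r‖ = |r|` (`n` non-empty; `ℓ²`-operator norm). [folklore] -/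
theorem norm_cen [Nonempty n] (r : ℝ) : ‖(cen r : Matrix n n ℂ)‖ = |r| := by
  rw [cen, norm_smul, norm_one, mul_one, norm_mul, Complex.norm_real, Complex.norm_I, mul_one, Real.norm_eq_abs]

/-- **At the flat background the Hessian density of the witness IS the squared dressed curl**: `hessPlaq 1 X X p = ‖curl 1 X p‖²`
(`dcurl = 0`, `V(∂p) = 1`, `−nReTr(cen Δ · cen Δ) = Δ²`). [folklore] -/
theorem hessPlaq_flat_Xw [Nonempty n] (L k : ℕ) (p : T4AveragingDeficitWall.Plaq d) :
    hessPlaq (flat (d := d) (n := n)) (Xw n i₀ i₁ L k) (Xw n i₀ i₁ L k) p = ‖curl flat (Xw n i₀ i₁ L k) p‖ ^ 2 := by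
  rw [hessPlaq, hessPlaqAt, dcurlAt_Xw_eq_zero, zero_add, curl, curlAt_flat_Xw, T4AveragingDeficitWall.hol_flat, Units.val_one,
    mul_one, nReTr_cen_mul_cen, neg_neg, norm_cen, sq_abs, sq]

/-- `hess 1 X X (perWin d P) = curlSq 1 X (periodBox P)`. [folklore] -/
theorem hess_flat_Xw_eq_curlSq [Nonempty n] (L k P : ℕ) :
    hess (flat (d := d) (n := n)) (Xw n i₀ i₁ L k) (Xw n i₀ i₁ L k) (perWin d P)
      = curlSq flat (Xw n i₀ i₁ L k) (periodBox P) := by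
  rw [hess, perWin, curlSq, sum_product]
  exact sum_congr rfl fun z _ => sum_congr rfl fun π _ => hessPlaq_flat_Xw L k (z, π)

/-- Sums over the period box of a function of ONE coordinate: `Σ_{x∈[0,P)^{m+2}} g(x_{i₁}) = P^{m+1}·Σ_{t<P} g(t)`. [folklore] -/
theorem sum_periodBox_coord {m : ℕ} (i₁ : Fin (m + 2)) (P : ℕ) (g : ℤ → ℝ) :
    ∑ x ∈ periodBox (d := m + 2) P, g (x i₁) = (P : ℝ) ^ (m + 1) * ∑ t ∈ range P, g t := by
  have hinj : Function.Injective (boxVec (d := m + 2) P) := by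
    intro r r' h
    funext κ
    have := congrFun h κ
    simp only [boxVec, Nat.cast_inj] at this
    exact Fin.ext this
  rw [periodBox, sum_image fun r _ r' _ h => hinj h]
  simp only [boxVec]
  rw [sum_coord (m + 1) P i₁ (fun t : Fin P => g ((t : ℕ) : ℤ)), nsmul_eq_mul, Nat.cast_pow,
    Fin.sum_univ_eq_sum_range (fun t => g ((t : ℕ) : ℤ)) P]

/-- `dirSq X (periodBox P) = P^{m+1}·Σ_{t<P} cos²(2πt/L^k)`. [folklore] -/
theorem dirSq_Xw [Nonempty n] {m : ℕ} {i₀ i₁ : Fin (m + 2)} (L k P : ℕ) :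
    dirSq (Xw n i₀ i₁ L k) (periodBox P)
      = (P : ℝ) ^ (m + 1) * ∑ t ∈ range P, Real.cos (2 * Real.pi * t / (L : ℝ) ^ k) ^ 2 := by
  unfold dirSq
  have hpt : ∀ x : Site (m + 2), ∑ κ : Fin (m + 2), ‖Xw n i₀ i₁ L k x κ‖ ^ 2
      = Real.cos (2 * Real.pi * (x i₁ : ℤ) / (L : ℝ) ^ k) ^ 2 := by
    intro x
    rw [Fintype.sum_eq_single i₀ fun κ hκ => by rw [Xw_apply, if_neg hκ, norm_zero, zero_pow two_ne_zero], Xw_apply,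
      if_pos rfl, norm_cen, sq_abs]
    congr 2; ring
  simp_rw [hpt]
  exact sum_periodBox_coord i₁ P (fun w => Real.cos (2 * Real.pi * w / (L : ℝ) ^ k) ^ 2)

/-- `curlSq 1 X (periodBox P) = P^{m+1}·Σ_{t<P} (cos(2πt/L^k) − cos(2π(t+1)/L^k))²` (`i₀ = 0 < i₁`: only the planes
`(i₀, i₁)` carry curl). [folklore] -/
theorem curlSq_Xw [Nonempty n] {m : ℕ} {i₀ i₁ : Fin (m + 2)} (h0 : (i₀ : ℕ) = 0) (h01 : i₀ ≠ i₁) (L k P : ℕ) :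
    curlSq (flat (d := m + 2) (n := n)) (Xw n i₀ i₁ L k) (periodBox P)
      = (P : ℝ) ^ (m + 1) * ∑ t ∈ range P,
          (Real.cos (2 * Real.pi * t / (L : ℝ) ^ k) - Real.cos (2 * Real.pi * (t + 1) / (L : ℝ) ^ k)) ^ 2 := by
  have hlt : i₀ < i₁ := by
    rw [Fin.lt_def, h0]; exact Nat.pos_of_ne_zero fun h => h01 (Fin.ext (h0.trans h.symm))
  let π₀ : T4AveragingDeficitWall.Plane (m + 2) := ⟨(i₀, i₁), hlt⟩
  unfold curlSq
  have hpt : ∀ z : Site (m + 2), ∑ π : T4AveragingDeficitWall.Plane (m + 2), ‖curl flat (Xw n i₀ i₁ L k) (z, π)‖ ^ 2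
      = (Real.cos (2 * Real.pi * (z i₁ : ℤ) / (L : ℝ) ^ k) - Real.cos (2 * Real.pi * ((z i₁ : ℤ) + 1) / (L : ℝ) ^ k)) ^ 2 := by
    intro z
    rw [Fintype.sum_eq_single π₀]
    · rw [curl, curlAt_flat_Xw, norm_cen, sq_abs]
      have h1 : ((π₀ : T4AveragingDeficitWall.Plane (m + 2)).1.1 = i₀) := rfl
      have h2 : ((π₀ : T4AveragingDeficitWall.Plane (m + 2)).1.2 = i₁) := rfl
      simp only [h1, h2, if_true, if_neg (Ne.symm h01), add_zero, Pi.add_apply, e_apply]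
      congr 1
      push_cast
      ring
    · intro π hπ
      rw [curl, curlAt_flat_Xw]
      obtain ⟨⟨μ, ν⟩, hμν⟩ := π
      have hν0 : ν ≠ i₀ := by
        intro h; subst h
        have : (μ : ℕ) < (ν : ℕ) := hμν
        omega
      by_cases hμ0 : μ = i₀
      · subst hμ0
        have hν1 : ν ≠ i₁ := by
          intro h; subst h; exact hπ rfl
        simp [hν0, coord_add_e_of_ne hν1]
      · simp [hμ0, hν0]
  simp_rw [hpt]
  rw [sum_periodBox_coord i₁ P (fun w => (Real.cos (2 * Real.pi * w / (L : ℝ) ^ k)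
    - Real.cos (2 * Real.pi * (w + 1) / (L : ℝ) ^ k)) ^ 2)]
  simp only [Int.cast_natCast]

/-- The two trigonometric block sums: `Σ_{t<P} cos²(2πt/M) = P/2` and
`Σ_{t<P} (cos(2πt/M) − cos(2π(t+1)/M))² = 4 sin²(π/M)·P/2` for `3 ≤ M ∣ P`. [folklore] -/
theorem trig_sums {M P : ℕ} (hM : 3 ≤ M) (hMP : M ∣ P) :
    (∑ t ∈ range P, Real.cos (2 * Real.pi * t / (M : ℝ)) ^ 2 = (P : ℝ) / 2) ∧
    (∑ t ∈ range P, (Real.cos (2 * Real.pi * t / (M : ℝ)) - Real.cos (2 * Real.pi * (t + 1) / (M : ℝ))) ^ 2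
      = 4 * Real.sin (Real.pi / M) ^ 2 * ((P : ℝ) / 2)) := by
  have hM0 : (M : ℝ) ≠ 0 := by exact_mod_cast (by omega : M ≠ 0)
  constructor
  · have h := sum_cos_sq_eq hM hMP 0
    simpa using h
  · have h := sum_cos_sq_eq hM hMP (Real.pi / M - Real.pi / 2)
    have hterm : ∀ t : ℕ, (Real.cos (2 * Real.pi * t / (M : ℝ)) - Real.cos (2 * Real.pi * (t + 1) / (M : ℝ))) ^ 2
        = 4 * Real.sin (Real.pi / M) ^ 2 * Real.cos (2 * Real.pi * t / M + (Real.pi / M - Real.pi / 2)) ^ 2 := by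
      intro t
      have e1 : (2 * Real.pi * t / M + 2 * Real.pi * (t + 1) / M) / 2 = 2 * Real.pi * t / M + Real.pi / M := by
        field_simp; ring
      have e2 : (2 * Real.pi * t / M - 2 * Real.pi * (t + 1) / M) / 2 = -(Real.pi / M) := by
        field_simp; ring
      rw [Real.cos_sub_cos, e1, e2, Real.sin_neg, show 2 * Real.pi * t / M + (Real.pi / M - Real.pi / 2)
        = (2 * Real.pi * t / M + Real.pi / M) - Real.pi / 2 by ring, Real.cos_sub_pi_div_two]
      ring
    rw [sum_congr rfl fun t _ => hterm t, ← mul_sum, h]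

end

end Summit.QuantumFields.BalabanUV.T4Continuum.NE3TangentNoGoForms
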